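import Summits.PneNP.PneNP.Theorems.ConvexRankGatesCaptureDualRealCorankLemmas
import HarnessLib

/-!
# Crux `Capture` (stmt-PneNP-2659) — duality audit, cell D6: REAL CO-RANK doors are ONE CONV (SDP) gate

The GRANK door `[rk{a_i : v_i = 1} ≥ θ]` (one linear matroid over `ℝ`) has Boolean dual the CO-RANK door

  `v ↦ [the UNselected equations a_i · y = 0 (v_i = 0) have ≥ r linearly independent solutions]`,
  `r = d − θ + 1` — a DIMENSION LOWER BOUND for the solution space of the unselected homogeneous system.

Assembled here from the lemmas of `ConvexRankGatesCaptureDualRealCorankLemmas.lean`: the SDP with matrix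
variable `[[Y₁₁, 0], [0, Y₂₂]] ⪰ 0`, rows `Y₁₂ = 0`, `Y₁₁ + Y₂₂ = I`, `tr Y₁₁ ≥ r`, `a_iᵀ Y₁₁ = 0` for
unselected `i` and `|(a_iᵀ Y₁₁)_k| ≤ ‖a_i‖₁ · [v_i]` for selected `i` (`4d² + 2nd + 1` rows, a `2d × 2d`
variable), is feasible iff the co-rank door accepts (`realCorank_isConvGate`). Hence the dual of the real
rank-threshold GRANK door is ONE CONV gate: this cell of the duality audit
(`Cruxes/Capture/DUALITY-AUDIT-c7.md`) PASSES in the kernel. [folklore]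
-/

namespace Summit.PneNP.PneNP.Theorems.Capture.DualityAudit

set_option linter.dupNamespace false -- `Summit.PneNP.PneNP.…`: summit = sub-problem (D-0017)

open Literature.Computability.Complexity Finset Matrix

noncomputable section

/-- **Duality-audit cell D6 (registered sub-goal `realCorank_isConvGate`)**: the REAL CO-RANK door
`v ↦ [the unselected homogeneous equations a_i · y = 0 (v_i = 0) have ≥ r linearly independent solutions]`
— the Boolean dual of the real rank-threshold GRANK door — is ONE CONV (SDP) gate of width
`4d² + 2nd + 2d + 1`: matrix variable `[[Y₁₁, 0], [0, Y₂₂]] ⪰ 0` with `Y₁₁ + Y₂₂ = I`, `tr Y₁₁ ≥ r`,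
`a_iᵀ Y₁₁ = 0` for unselected `i` and `|(a_iᵀ Y₁₁)_k| ≤ ‖a_i‖₁ · [v_i]` for selected `i`. [folklore] -/
theorem realCorank_isConvGate : ∀ (n d r : ℕ) (a : Fin n → Fin d → ℝ) (f : (Fin n → Bool) → Bool),
    (∀ v, f v = true ↔ ∃ w : Fin r → Fin d → ℝ, LinearIndependent ℝ w ∧
      ∀ t i, v i = false → a i ⬝ᵥ w t = 0) →
    IsConvGate (4 * (d * d) + 2 * (n * d) + 2 * d + 1) ⟨n, f⟩ := by
  intro n d r a f hf
  classical
  -- rows and data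
  let Rw := ((Fin d × Fin d) × Bool) ⊕ ((Fin d × Fin d) × Bool) ⊕ Unit ⊕ ((Fin n × Fin d) × Bool)
  let Q := Fin d ⊕ Fin d
  let sgn : Bool → ℝ := fun s => if s then 1 else -1
  let M : Fin n → ℝ := fun i => ∑ j, |a i j|
  let A : Rw → Matrix Q Q ℝ := fun row => match row with
    | Sum.inl ((j, k), s) => sgn s • Matrix.single (Sum.inr k) (Sum.inl j) (1 : ℝ)
    | Sum.inr (Sum.inl ((j, k), s)) =>
        sgn s • (Matrix.single (Sum.inl k) (Sum.inl j) (1 : ℝ) + Matrix.single (Sum.inr k) (Sum.inr j) 1)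
    | Sum.inr (Sum.inr (Sum.inl _)) => -∑ j, Matrix.single (Sum.inl j) (Sum.inl j) (1 : ℝ)
    | Sum.inr (Sum.inr (Sum.inr ((i, k), s))) => sgn s • ∑ j, Matrix.single (Sum.inl k) (Sum.inl j) (a i j)
  let b : Rw → ℝ := fun row => match row with
    | Sum.inl _ => 0
    | Sum.inr (Sum.inl ((j, k), s)) => sgn s * (if j = k then 1 else 0)
    | Sum.inr (Sum.inr (Sum.inl _)) => -(r : ℝ)
    | Sum.inr (Sum.inr (Sum.inr _)) => 0
  let B : Rw → Fin n → ℝ := fun row i' => match row with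
    | Sum.inl _ => 0
    | Sum.inr (Sum.inl _) => 0
    | Sum.inr (Sum.inr (Sum.inl _)) => 0
    | Sum.inr (Sum.inr (Sum.inr ((i, _), _))) => if i' = i then M i else 0
  have hM0 : ∀ i, 0 ≤ M i := fun i => Finset.sum_nonneg fun j _ => abs_nonneg _
  have hB : ∀ row i', 0 ≤ B row i' := by
    rintro (_ | _ | _ | ⟨⟨i, k⟩, s⟩) i' <;> simp only [B] <;> try exact le_rfl
    split_ifs
    · exact hM0 i
    · exact le_rfl
  have hwidth : Fintype.card Rw + Fintype.card Q = 4 * (d * d) + 2 * (n * d) + 2 * d + 1 := by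
    simp only [Rw, Q, Fintype.card_sum, Fintype.card_prod, Fintype.card_fin, Fintype.card_bool,
      Fintype.card_unit]
    ring
  rw [← hwidth]
  refine isConvGate_of_sdp A b B hB f fun v => ?_
  -- the rows, evaluated at a matrix `Y`
  have hind : ∀ i, (∑ i', (if i' = i then M i else 0) * (if v i' then (1 : ℝ) else 0)) =
      M i * (if v i then 1 else 0) := fun i => by
    rw [Finset.sum_eq_single i (fun i' _ hne => by rw [if_neg hne, zero_mul])
      (fun h => absurd (Finset.mem_univ i) h), if_pos rfl]
  have hsgn : ∀ (s : Bool) (x y : ℝ), (sgn s * x ≤ sgn s * y + 0) ↔ (if s then x ≤ y else y ≤ x) := by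
    intro s x y
    cases s <;> simp [sgn]
  have hrow1 : ∀ (Y : Matrix Q Q ℝ) (j k : Fin d) (s : Bool),
      ((A (Sum.inl ((j, k), s)) * Y).trace ≤ b (Sum.inl ((j, k), s)) +
          ∑ i', B (Sum.inl ((j, k), s)) i' * (if v i' then (1 : ℝ) else 0)) ↔
        (if s then Y (Sum.inl j) (Sum.inr k) ≤ 0 else 0 ≤ Y (Sum.inl j) (Sum.inr k)) := fun Y j k s => by
    simp only [A, b, B, Matrix.smul_mul, Matrix.trace_smul, Matrix.trace_single_mul, smul_eq_mul, one_mul,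
      zero_mul, Finset.sum_const_zero, zero_add]
    cases s <;> simp [sgn]
  have hrow2 : ∀ (Y : Matrix Q Q ℝ) (j k : Fin d) (s : Bool),
      ((A (Sum.inr (Sum.inl ((j, k), s))) * Y).trace ≤ b (Sum.inr (Sum.inl ((j, k), s))) +
          ∑ i', B (Sum.inr (Sum.inl ((j, k), s))) i' * (if v i' then (1 : ℝ) else 0)) ↔
        (if s then Y (Sum.inl j) (Sum.inl k) + Y (Sum.inr j) (Sum.inr k) ≤ (if j = k then 1 else 0)
          else (if j = k then (1 : ℝ) else 0) ≤ Y (Sum.inl j) (Sum.inl k) + Y (Sum.inr j) (Sum.inr k)) :=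
      fun Y j k s => by
    simp only [A, b, B, Matrix.smul_mul, Matrix.add_mul, Matrix.trace_smul, Matrix.trace_add,
      Matrix.trace_single_mul, smul_eq_mul, one_mul, zero_mul, Finset.sum_const_zero]
    exact hsgn s _ _
  have hrow3 : ∀ (Y : Matrix Q Q ℝ) (u : Unit),
      ((A (Sum.inr (Sum.inr (Sum.inl u))) * Y).trace ≤ b (Sum.inr (Sum.inr (Sum.inl u))) +
          ∑ i', B (Sum.inr (Sum.inr (Sum.inl u))) i' * (if v i' then (1 : ℝ) else 0)) ↔
        (r : ℝ) ≤ ∑ j, Y (Sum.inl j) (Sum.inl j) := fun Y u => by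
    simp only [A, b, B, Matrix.neg_mul, Matrix.trace_neg, Matrix.sum_mul, Matrix.trace_sum,
      Matrix.trace_single_mul, smul_eq_mul, one_mul, zero_mul, Finset.sum_const_zero, add_zero]
    constructor <;> intro h <;> linarith
  have hrow4 : ∀ (Y : Matrix Q Q ℝ) (i : Fin n) (k : Fin d) (s : Bool),
      ((A (Sum.inr (Sum.inr (Sum.inr ((i, k), s)))) * Y).trace ≤ b (Sum.inr (Sum.inr (Sum.inr ((i, k), s)))) +
          ∑ i', B (Sum.inr (Sum.inr (Sum.inr ((i, k), s)))) i' * (if v i' then (1 : ℝ) else 0)) ↔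
        sgn s * (∑ j, a i j * Y (Sum.inl j) (Sum.inl k)) ≤ M i * (if v i then 1 else 0) := fun Y i k s => by
    simp only [A, b, B, Matrix.smul_mul, Matrix.trace_smul, Matrix.sum_mul, Matrix.trace_sum,
      Matrix.trace_single_mul, smul_eq_mul, zero_add, hind]
  constructor
  · -- completeness: the projector onto `r` independent solutions
    intro hv
    obtain ⟨w, hw, hwU⟩ := (hf v).1 hv
    obtain ⟨Y, hY, hoff1, hoff2, hdiag, htr, hU, hbd⟩ :=
      exists_projector_of_li_solutions a {i | v i = false} w hw (fun t i hi => hwU t i hi)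
    refine ⟨Y, hY, fun row => ?_⟩
    rcases row with ⟨⟨j, k⟩, s⟩ | ⟨⟨j, k⟩, s⟩ | u | ⟨⟨i, k⟩, s⟩
    · rw [hrow1 Y j k s, hoff1]
      cases s <;> simp
    · rw [hrow2 Y j k s, hdiag]
      cases s <;> simp
    · rw [hrow3 Y u, htr]
    · rw [hrow4 Y i k s]
      cases hvi : v i
      · have h0 : ∑ j, a i j * Y (Sum.inl j) (Sum.inl k) = 0 := hU i hvi k
        rw [h0, mul_zero]
        simp
      · simp only [if_true, mul_one]
        have habs : |∑ j, a i j * Y (Sum.inl j) (Sum.inl k)| ≤ M i := by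
          calc |∑ j, a i j * Y (Sum.inl j) (Sum.inl k)| ≤ ∑ j, |a i j * Y (Sum.inl j) (Sum.inl k)| :=
                Finset.abs_sum_le_sum_abs _ _
            _ ≤ ∑ j, |a i j| := Finset.sum_le_sum fun j _ => by
                rw [abs_mul]
                exact mul_le_of_le_one_right (abs_nonneg _) (hbd j k)
        have hs1 : |sgn s| = 1 := by cases s <;> simp [sgn]
        calc sgn s * ∑ j, a i j * Y (Sum.inl j) (Sum.inl k)
            ≤ |sgn s * ∑ j, a i j * Y (Sum.inl j) (Sum.inl k)| := le_abs_self _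
          _ = |∑ j, a i j * Y (Sum.inl j) (Sum.inl k)| := by rw [abs_mul, hs1, one_mul]
          _ ≤ M i := habs
  · -- soundness: blocks of a feasible `Y` give `P ⪰ 0`, `P' ⪰ 0`, `P + P' = I`, `tr P ≥ r`, `a_iᵀ P = 0`
    rintro ⟨Y, hY, hc⟩
    have hoff : ∀ j k, Y (Sum.inl j) (Sum.inr k) = 0 := fun j k => by
      have h1 := (hrow1 Y j k true).1 (hc (Sum.inl ((j, k), true)))
      have h2 := (hrow1 Y j k false).1 (hc (Sum.inl ((j, k), false)))
      simp only [if_true, Bool.false_eq_true, if_false] at h1 h2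
      exact le_antisymm h1 h2
    have hdiag : ∀ j k, Y (Sum.inl j) (Sum.inl k) + Y (Sum.inr j) (Sum.inr k) = if j = k then 1 else 0 :=
      fun j k => by
      have h1 := (hrow2 Y j k true).1 (hc (Sum.inr (Sum.inl ((j, k), true))))
      have h2 := (hrow2 Y j k false).1 (hc (Sum.inr (Sum.inl ((j, k), false))))
      simp only [if_true, Bool.false_eq_true, if_false] at h1 h2
      exact le_antisymm h1 h2
    have htr : (r : ℝ) ≤ ∑ j, Y (Sum.inl j) (Sum.inl j) := (hrow3 Y ()).1 (hc (Sum.inr (Sum.inr (Sum.inl ()))))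
    have hU : ∀ i, v i = false → ∀ k, ∑ j, a i j * Y (Sum.inl j) (Sum.inl k) = 0 := fun i hvi k => by
      have h1 := (hrow4 Y i k true).1 (hc (Sum.inr (Sum.inr (Sum.inr ((i, k), true)))))
      have h2 := (hrow4 Y i k false).1 (hc (Sum.inr (Sum.inr (Sum.inr ((i, k), false)))))
      simp only [sgn, if_true, one_mul, Bool.false_eq_true, if_false, hvi, mul_zero] at h1 h2
      linarith
    let P : Matrix (Fin d) (Fin d) ℝ := Y.submatrix Sum.inl Sum.inl
    let P' : Matrix (Fin d) (Fin d) ℝ := Y.submatrix Sum.inr Sum.inr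
    have hPsum : P + P' = 1 := by
      ext j k
      simp only [P, P', Matrix.add_apply, Matrix.submatrix_apply, Matrix.one_apply]
      exact hdiag j k
    obtain ⟨w, hw, hwU⟩ := exists_li_solutions_of_projector a {i | v i = false} P P'
      (hY.submatrix _) (hY.submatrix _) hPsum (by simpa [P, Matrix.trace] using htr)
      (fun i hi => funext fun k => hU i hi k)
    exact (hf v).2 ⟨w, hw, fun t i hi => hwU t i hi⟩

end

end Summit.PneNP.PneNP.Theorems.Capture.DualityAudit
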